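import Summits.QuantumFields.BalabanUV.T4Continuum.Support.NE3TangentCovariantStructure
import Summits.QuantumFields.BalabanUV.T4Continuum.Support.NE3NestedBlockMeanCovariance
import Summits.QuantumFields.BalabanUV.T4Continuum.Support.NE3CovariantLineSumsL2
import HarnessLib

/-!
# T⁴ programme, node NE3, route Π row Π-D — THE DIFFERENTIAL OF THE BLOCK AVERAGE DOES NOT CONTRACT GENERAL DIRECTIONS:
# on a GAUGE SPIKE at the flat background the `l²` ratio `‖D_1 Z‖² ∕ ‖Z‖²` is EXACTLY `1` (kernel witness for FINDING F-ne3leaf04g6-1)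

NE3 formalisation swarm `b2b-balaban-t4-ne3-formalise-*`, LEAF PROVER 04 (gen 6).  The owner's design note
`HOME/t4/b2b-balaban-t4-ne3-p1/g24/D-ne3p1-g24-1.md` §6 row Π-D displays `‖D_W Z‖² ≤ 2·M^{2−d}·‖Z‖²` for a GENERAL tangent datum `Z`.
That line is FALSE already at `W = 1`: for the periodic gauge spike `Z = gaugeDir 1 φ`, `φ x = A·[x ∈ (L·N)ℤ^d]` (`A ∈ 𝔲(n)`), the exact
covariance of Bałaban's average (the tree's `NE3TangentCovariantStructure.cpush_gaugeDir`, (45) p. 24) gives `D_1 Z = gaugeDir 1 (φ ∘ (L·))`,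
the coarse gauge spike, and a direct count gives `‖D_1 Z‖²_{[0,N)^d} = ‖Z‖²_{[0,LN)^d} = 2·d·‖A‖²` — ratio `1 > 2·L^{2−d}` for `d ≥ 3, L ≥ 2`.
(On the FRAME-FREE slice the contraction does hold — `NE3FramePotBoundWClass.l2sq_QbarIter_le_class`; the gauge part must be split off
first, cf. Π-G0.)

CONTENT (all [folklore]; 0 sorry; 0 def — the spike is the hypothesis `hφ : ∀ x, φ x = if (∀ i, (P:ℤ) ∣ x i) then A else 0`):
§1 the spike: periodicity, skewness, coarse pull-back `φ_{LN} (L·y) = φ_N y`; §2 the count `l2sq (periodBox P) (gaugeDir 1 φ_P) = 2·d·‖A‖²`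
(`P ≥ 2`); §3 END **`l2sq_cpush_one_gaugeDir_spike`** (both sides `= 2·d·‖A‖²`) and the NO-GO
**`not_cpush_contracts_general`**: `¬ ∀ Z periodic skew, l2sq_N (cpush L 1 Z) ≤ 2·(L²∕L^d)·l2sq_{LN} Z` (`d ≥ 3`, `L ≥ 2`, `N ≥ 2`).

HONEST FRAMING.  Lattice kinematics at the FLAT configuration only; a located correction to one displayed line of a design note, not
a statement about Bałaban's minimisers; (P♮)_W, (ML_w), T-E_w and NE3 are NOT proved; spine PROVED 0∕9; finite T⁴ rung (B)+1 — NOT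
infinite volume, NOT mass gap, NOT BetaPertH, NOT Clay.  ABSOLUTE RULE kept (no printed sentence is a hypothesis; context only:
[Balaban1985Averaging] (45) p. 24).  PLACEMENT: `Summits/QuantumFields/BalabanUV/`.
HONEST DEPENDENCY: continuum YM on T⁴ ⇐ BetaPertH ∧ nine spine estimates (0/9 proved); BetaPertH ⇐ (D1) ∧ (D4) ∧ CAP+tail; G-an2-4 gates asym, D1 and NE2/3/4.
-/

set_option autoImplicit false

open scoped BigOperators Matrix.Norms.L2Operator
open Finset

namespace Summit.QuantumFields.BalabanUV.T4Continuum.NE3LinearisedAverageGaugeSpike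

open Literature.MathematicalPhysics.QuantumFieldTheory.Balaban1983to89
open B7Prop1Explicit B7Prop2Explicit
open T4AveragingDeficitWall (IsUnitaryCfg SmallField Ad flat_mem_classes)
open T4AveragingDeficitWallBoundary (IsPeriodicCfg periodBox mem_periodBox)
open AveragingDeficitPeriodicCounting (IsPeriodicDir)
open AveragingDeficitMultiLevelPrep (cpush)
open BlockAveragePushDirGauge (gaugeDir isPeriodicDir_gaugeDir)
open NE3TangentCovariantStructure (cpush_gaugeDir)
open NE3NestedBlockMeanCovariance (cavg_one)
open NE3CovariantLineSumsL2 (l2sq)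

noncomputable section

variable {d : ℕ} {n : Type*} [Fintype n] [DecidableEq n]

/-! ## §1 The periodic spike `φ_P x = A·[x ∈ Pℤ^d]` -/

omit [Fintype n] [DecidableEq n] in
/-- Coordinates of a shifted site: `(x + c • e i) j = x j + c·[j = i]`. [folklore] -/
theorem add_smul_e_apply (x : Site d) (c : ℤ) (i j : Fin d) :
    (x + c • e i) j = x j + (if j = i then c else 0) := by
  simp only [Pi.add_apply, Pi.smul_apply, e, Pi.single_apply, smul_eq_mul, mul_ite, mul_one, mul_zero]

omit [Fintype n] [DecidableEq n] in
/-- The spike is `P`-periodic. [folklore] -/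
theorem spike_periodic {P : ℕ} {A : Matrix n n ℂ} {φ : Site d → Matrix n n ℂ} (hφ : ∀ x, φ x = if (∀ i, (P : ℤ) ∣ x i) then A else 0)
    (x : Site d) (i : Fin d) : φ (x + (P : ℤ) • e i) = φ x := by
  rw [hφ, hφ x]
  have h : (∀ j, (P : ℤ) ∣ (x + (P : ℤ) • e i) j) ↔ ∀ j, (P : ℤ) ∣ x j := by
    refine forall_congr' fun j => ?_
    rw [add_smul_e_apply]
    split_ifs
    · exact dvd_add_left (dvd_refl _)
    · rw [add_zero]
  simp only [h]

omit [Fintype n] [DecidableEq n] in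
/-- The spike is skew-adjoint-valued when `A` is. [folklore] -/
theorem spike_skew {P : ℕ} {A : Matrix n n ℂ} (hA : A ∈ skewAdjoint (Matrix n n ℂ)) {φ : Site d → Matrix n n ℂ}
    (hφ : ∀ x, φ x = if (∀ i, (P : ℤ) ∣ x i) then A else 0) (x : Site d) : φ x ∈ skewAdjoint (Matrix n n ℂ) := by
  rw [hφ]
  split_ifs
  · exact hA
  · exact (skewAdjoint (Matrix n n ℂ)).zero_mem

omit [Fintype n] [DecidableEq n] in
/-- Coarse pull-back of the fine spike: `φ_{L·N} (L·y) = φ_N y` (`L ≥ 1`). [folklore] -/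
theorem spike_pullback {L N : ℕ} (hL : 1 ≤ L) {A : Matrix n n ℂ} {φ : Site d → Matrix n n ℂ}
    (hφ : ∀ x, φ x = if (∀ i, ((L * N : ℕ) : ℤ) ∣ x i) then A else 0) (y : Site d) :
    φ ((L : ℤ) • y) = if (∀ i, (N : ℤ) ∣ y i) then A else 0 := by
  rw [hφ]
  have hL0 : (L : ℤ) ≠ 0 := by exact_mod_cast (by omega : L ≠ 0)
  have h : (∀ i, ((L * N : ℕ) : ℤ) ∣ ((L : ℤ) • y) i) ↔ ∀ i, (N : ℤ) ∣ y i := by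
    refine forall_congr' fun i => ?_
    rw [Pi.smul_apply, smul_eq_mul, Nat.cast_mul]
    exact mul_dvd_mul_iff_left hL0
  simp only [h]

/-! ## §2 The count at the flat background -/

omit [Fintype n] [DecidableEq n] in
/-- In the period box, `P ∣ x i` for all `i` iff `x = 0`. [folklore] -/
theorem forall_dvd_iff_eq_zero {P : ℕ} {x : Site d} (hx : x ∈ periodBox P) :
    (∀ i, (P : ℤ) ∣ x i) ↔ x = 0 := by
  rw [mem_periodBox] at hx
  constructor
  · intro h
    funext i
    exact Int.eq_zero_of_dvd_of_nonneg_of_lt (hx i).1 (hx i).2 (h i)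
  · rintro rfl i
    exact dvd_zero _

omit [Fintype n] [DecidableEq n] in
/-- In the period box (`P ≥ 1`), `P ∣ (x + e κ) i` for all `i` iff `x = (P−1)·e κ`. [folklore] -/
theorem forall_dvd_succ_iff {P : ℕ} (hP : 1 ≤ P) {x : Site d} (hx : x ∈ periodBox P) (κ : Fin d) :
    (∀ i, (P : ℤ) ∣ (x + e κ) i) ↔ x = ((P : ℤ) - 1) • e κ := by
  rw [mem_periodBox] at hx
  have hP0 : (0 : ℤ) < P := by exact_mod_cast hP
  constructor
  · intro h
    funext j
    have hj := h j
    rw [show x + e κ = x + (1 : ℤ) • e κ by rw [one_smul], add_smul_e_apply] at hj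
    rw [Pi.smul_apply, e, Pi.single_apply, smul_eq_mul, mul_ite, mul_one, mul_zero]
    split_ifs with hjk
    · rw [if_pos hjk] at hj
      obtain ⟨c, hc⟩ := hj
      have h1 : 0 < (P : ℤ) * c := by rw [← hc]; linarith [(hx j).1]
      have h2 : (P : ℤ) * c ≤ (P : ℤ) * 1 := by rw [← hc, mul_one]; linarith [(hx j).2]
      have hc1 : 0 < c := pos_of_mul_pos_right h1 hP0.le
      have hc2 : c ≤ 1 := le_of_mul_le_mul_left h2 hP0
      have hc3 : c = 1 := le_antisymm hc2 hc1
      rw [hc3, mul_one] at hc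
      linarith
    · rw [if_neg hjk, add_zero] at hj
      exact Int.eq_zero_of_dvd_of_nonneg_of_lt (hx j).1 (hx j).2 hj
  · rintro rfl i
    rw [show ((P : ℤ) - 1) • e κ + e κ = (P : ℤ) • (e κ : Site d) by
      rw [sub_smul, one_smul, sub_add_cancel]]
    rw [Pi.smul_apply, smul_eq_mul]
    exact dvd_mul_right _ _

omit [Fintype n] [DecidableEq n] in
/-- `0 ∈ [0,P)^d` for `P ≥ 1`. [folklore] -/
theorem zero_mem_periodBox {P : ℕ} (hP : 1 ≤ P) : (0 : Site d) ∈ periodBox P := by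
  rw [mem_periodBox]
  intro κ
  refine ⟨le_rfl, ?_⟩
  simp only [Pi.zero_apply]
  exact_mod_cast hP

omit [Fintype n] [DecidableEq n] in
/-- `(P−1)·e κ ∈ [0,P)^d` for `P ≥ 1`. [folklore] -/
theorem corner_mem_periodBox {P : ℕ} (hP : 1 ≤ P) (κ : Fin d) : ((P : ℤ) - 1) • (e κ : Site d) ∈ periodBox P := by
  rw [mem_periodBox]
  intro j
  rw [Pi.smul_apply, e, Pi.single_apply, smul_eq_mul, mul_ite, mul_one, mul_zero]
  have hP1 : (1 : ℤ) ≤ P := by exact_mod_cast hP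
  split_ifs
  · exact ⟨by linarith, by linarith⟩
  · exact ⟨le_rfl, by linarith⟩

/-- The gauge direction at the flat background is the plain forward difference: `gaugeDir 1 φ x μ = φ x − φ (x + e μ)`. [folklore] -/
theorem gaugeDir_one_apply (φ : Site d → Matrix n n ℂ) (x : Site d) (μ : Fin d) :
    gaugeDir (1 : Site d → Fin d → (Matrix n n ℂ)ˣ) φ x μ = φ x - φ (x + e μ) := by
  simp only [gaugeDir, Pi.one_apply, inv_one, AveragingDeficitNearIdentity.Ad_one]

/-- Pointwise value of the squared spike difference in the period box (`P ≥ 2`): `‖A‖²` at `x = 0` and at `x = (P−1)e κ`, else `0`. [folklore] -/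
theorem normSq_spike_diff {P : ℕ} (hP : 2 ≤ P) {A : Matrix n n ℂ} {φ : Site d → Matrix n n ℂ}
    (hφ : ∀ x, φ x = if (∀ i, (P : ℤ) ∣ x i) then A else 0) {x : Site d} (hx : x ∈ periodBox P) (κ : Fin d) :
    ‖φ x - φ (x + e κ)‖ ^ 2 = (if x = 0 then ‖A‖ ^ 2 else 0) + (if x = ((P : ℤ) - 1) • e κ then ‖A‖ ^ 2 else 0) := by
  have hP1 : 1 ≤ P := by omega
  have hne : (0 : Site d) ≠ ((P : ℤ) - 1) • e κ := by
    intro h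
    have := congr_fun h κ
    rw [Pi.zero_apply, Pi.smul_apply, e, Pi.single_eq_same, smul_eq_mul, mul_one] at this
    have hP2 : (2 : ℤ) ≤ P := by exact_mod_cast hP
    linarith
  rw [hφ x, hφ (x + e κ)]
  simp only [forall_dvd_iff_eq_zero hx, forall_dvd_succ_iff hP1 hx κ]
  by_cases h0 : x = 0
  · subst h0
    rw [if_pos rfl, if_neg hne, if_pos rfl, if_neg hne, sub_zero, add_zero]
  · by_cases h1 : x = ((P : ℤ) - 1) • e κ
    · rw [if_neg h0, if_pos h1, if_neg h0, if_pos h1, zero_sub, norm_neg, zero_add]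
    · rw [if_neg h0, if_neg h1, if_neg h0, if_neg h1, sub_zero, norm_zero, add_zero]
      ring

/-- **THE COUNT**: `l2sq (periodBox P) (gaugeDir 1 φ_P) = 2·d·‖A‖²` for `P ≥ 2`. [folklore] -/
theorem l2sq_gaugeDir_one_spike {P : ℕ} (hP : 2 ≤ P) {A : Matrix n n ℂ} {φ : Site d → Matrix n n ℂ}
    (hφ : ∀ x, φ x = if (∀ i, (P : ℤ) ∣ x i) then A else 0) :
    l2sq (periodBox P) (gaugeDir (1 : Site d → Fin d → (Matrix n n ℂ)ˣ) φ) = 2 * d * ‖A‖ ^ 2 := by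
  have hP1 : 1 ≤ P := by omega
  unfold l2sq
  rw [Finset.sum_comm]
  have hκ : ∀ κ : Fin d, ∑ x ∈ periodBox P, ‖gaugeDir (1 : Site d → Fin d → (Matrix n n ℂ)ˣ) φ x κ‖ ^ 2 = 2 * ‖A‖ ^ 2 := by
    intro κ
    rw [Finset.sum_congr rfl fun x hx => by rw [gaugeDir_one_apply, normSq_spike_diff hP hφ hx κ],
      Finset.sum_add_distrib, Finset.sum_ite_eq' (periodBox P) (0 : Site d), Finset.sum_ite_eq',
      if_pos (zero_mem_periodBox hP1), if_pos (corner_mem_periodBox hP1 κ)]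
    ring
  rw [Finset.sum_congr rfl fun κ _ => hκ κ, Finset.sum_const, Finset.card_univ, Fintype.card_fin, nsmul_eq_mul]
  ring

/-! ## §3 END: the ratio is exactly `1`; the displayed contraction fails for general directions -/

/-- **`‖D_1 Z‖² = ‖Z‖² = 2·d·‖A‖²` ON THE GAUGE SPIKE** (`L ≥ 1`, `N ≥ 2`, `A ∈ 𝔲(n)`): the differential of Bałaban's block average at the
flat background maps the fine gauge spike to the coarse gauge spike (exact covariance `cpush_gaugeDir`), and both have squared `l²` norm
`2·d·‖A‖²` over one period. [folklore] -/
theorem l2sq_cpush_one_gaugeDir_spike [Nonempty n] {L N : ℕ} [NeZero N] [NeZero (L * N)] (hL : 1 ≤ L) (hN : 2 ≤ N)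
    {A : Matrix n n ℂ} (hA : A ∈ skewAdjoint (Matrix n n ℂ)) {φ : Site d → Matrix n n ℂ}
    (hφ : ∀ x, φ x = if (∀ i, ((L * N : ℕ) : ℤ) ∣ x i) then A else 0) :
    l2sq (periodBox N) (cpush L 1 (gaugeDir (1 : Site d → Fin d → (Matrix n n ℂ)ˣ) φ)) = 2 * d * ‖A‖ ^ 2
      ∧ l2sq (periodBox (L * N)) (gaugeDir (1 : Site d → Fin d → (Matrix n n ℂ)ˣ) φ) = 2 * d * ‖A‖ ^ 2 := by
  have hLN : 2 ≤ L * N := le_trans hN (Nat.le_mul_of_pos_left N (by omega))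
  obtain ⟨hu, hs⟩ := flat_mem_classes (d := d) (n := n) (a := 0) le_rfl
  refine ⟨?_, l2sq_gaugeDir_one_spike hLN hφ⟩
  have hcov := cpush_gaugeDir (d := d) (M := N) hL (W := 1) hu (fun _ _ _ => rfl) le_rfl (by norm_num) hs
    (spike_skew hA hφ) (spike_periodic hφ)
  rw [hcov, cavg_one]
  exact l2sq_gaugeDir_one_spike hN (spike_pullback hL hφ)

/-- **NO-GO FOR THE DISPLAYED ROW Π-D AS TYPED** (`d ≥ 1`, `L ≥ 1`, `N ≥ 2`, `2·L² < L^d` — e.g. `d ≥ 4, L ≥ 2`): it is NOT true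
that the differential of the block average contracts every periodic skew direction by the factor `2·L²∕L^d` in squared `l²` norm — the
gauge spike has ratio exactly `1`.  (The contraction holds on the frame-free slice only; the gauge part has to be split off first.) [folklore] -/
theorem not_cpush_contracts_general [Nonempty n] {L N : ℕ} [NeZero N] [NeZero (L * N)] (hd : 1 ≤ d) (hL : 1 ≤ L) (hN : 2 ≤ N)
    (hdL : 2 * (L : ℝ) ^ 2 < (L : ℝ) ^ d) :
    ¬ ∀ Z : Site d → Fin d → Matrix n n ℂ, IsPeriodicDir Z ((L * N : ℕ) : ℤ) → (∀ x μ, Z x μ ∈ skewAdjoint (Matrix n n ℂ)) →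
        l2sq (periodBox N) (cpush L 1 Z) ≤ 2 * ((L : ℝ) ^ 2 / (L : ℝ) ^ d) * l2sq (periodBox (L * N)) Z := by
  intro h
  set A : Matrix n n ℂ := Complex.I • (1 : Matrix n n ℂ) with hAdef
  have hA : A ∈ skewAdjoint (Matrix n n ℂ) := by
    rw [skewAdjoint.mem_iff, hAdef, star_smul, star_one, Complex.star_def, Complex.conj_I, neg_smul]
  have hA0 : A ≠ 0 := by
    intro h0
    obtain ⟨i⟩ := ‹Nonempty n›
    have := congr_fun (congr_fun h0 i) i
    rw [hAdef, Matrix.smul_apply, Matrix.one_apply_eq, smul_eq_mul, mul_one, Matrix.zero_apply] at this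
    exact Complex.I_ne_zero this
  set φ : Site d → Matrix n n ℂ := fun x => if (∀ i, ((L * N : ℕ) : ℤ) ∣ x i) then A else 0 with hφdef
  have hφ : ∀ x, φ x = if (∀ i, ((L * N : ℕ) : ℤ) ∣ x i) then A else 0 := fun _ => rfl
  obtain ⟨hc, hf⟩ := l2sq_cpush_one_gaugeDir_spike (d := d) hL hN hA hφ
  have hZ := h (gaugeDir 1 φ) (isPeriodicDir_gaugeDir (fun _ _ _ => rfl) (spike_periodic hφ))
    (fun x μ => by
      rw [gaugeDir_one_apply]
      exact (skewAdjoint (Matrix n n ℂ)).sub_mem (spike_skew hA hφ x) (spike_skew hA hφ (x + e μ)))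
  rw [hc, hf] at hZ
  have hApos : 0 < ‖A‖ ^ 2 := by positivity
  have hd0 : (0 : ℝ) < d := by exact_mod_cast (by omega : 0 < d)
  have hL0 : (0 : ℝ) < L := by exact_mod_cast (by omega : 0 < L)
  have hLd : (0 : ℝ) < (L : ℝ) ^ d := pow_pos hL0 d
  have hcpos : 0 < 2 * (d : ℝ) * ‖A‖ ^ 2 := mul_pos (mul_pos two_pos hd0) hApos
  have h1 : 1 ≤ 2 * ((L : ℝ) ^ 2 / (L : ℝ) ^ d) := by
    by_contra hlt
    push Not at hlt
    nlinarith [hZ, hcpos, mul_pos (sub_pos.mpr hlt) hcpos]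
  have h2 : (L : ℝ) ^ d ≤ 2 * (L : ℝ) ^ 2 := by
    have := mul_le_mul_of_nonneg_right h1 hLd.le
    rwa [one_mul, mul_assoc, div_mul_cancel₀ _ hLd.ne'] at this
  exact absurd h2 (not_le.mpr hdL)

/-- **THE T⁴ CASE** (`d ≥ 4`, `L ≥ 2`, `N ≥ 2`): the displayed contraction `‖D_1 Z‖² ≤ 2·L^{2−d}·‖Z‖²` fails for general periodic skew
directions. [folklore] -/
theorem not_cpush_contracts_general_of_four_le [Nonempty n] {L N : ℕ} [NeZero N] [NeZero (L * N)] (hd : 4 ≤ d) (hL : 2 ≤ L)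
    (hN : 2 ≤ N) :
    ¬ ∀ Z : Site d → Fin d → Matrix n n ℂ, IsPeriodicDir Z ((L * N : ℕ) : ℤ) → (∀ x μ, Z x μ ∈ skewAdjoint (Matrix n n ℂ)) →
        l2sq (periodBox N) (cpush L 1 Z) ≤ 2 * ((L : ℝ) ^ 2 / (L : ℝ) ^ d) * l2sq (periodBox (L * N)) Z := by
  refine not_cpush_contracts_general (by omega) (by omega) hN ?_
  have hL2 : (2 : ℝ) ≤ L := by exact_mod_cast hL
  have hsplit : (L : ℝ) ^ d = (L : ℝ) ^ (d - 2) * (L : ℝ) ^ 2 := by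
    rw [← pow_add, Nat.sub_add_cancel (by omega)]
  have h4 : (4 : ℝ) ≤ (L : ℝ) ^ (d - 2) :=
    calc (4 : ℝ) = 2 ^ 2 := by norm_num
      _ ≤ (L : ℝ) ^ 2 := pow_le_pow_left₀ (by norm_num) hL2 2
      _ ≤ (L : ℝ) ^ (d - 2) := pow_le_pow_right₀ (by linarith) (by omega)
  have hsq : (0 : ℝ) < (L : ℝ) ^ 2 := by positivity
  rw [hsplit]
  nlinarith [h4, hsq]

end

end Summit.QuantumFields.BalabanUV.T4Continuum.NE3LinearisedAverageGaugeSpike
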